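import Literature.AlgebraicGeometry.ModuliOfAbelianVarieties.SiegelModuliComplexUniformisation
import Literature.AlgebraicGeometry.ModuliOfAbelianVarieties.SiegelPrincipalLevelArithmeticGroup
import Literature.AlgebraicGeometry.ModuliOfAbelianVarieties.SiegelAdelicMarkingSamePoint
import Literature.AlgebraicGeometry.ModuliOfAbelianVarieties.SiegelAdelicCongrTransport
import Literature.AlgebraicGeometry.ModuliOfAbelianVarieties.SiegelPrincipalLevelSimilitudeTower
import Literature.AlgebraicGeometry.AbelianSchemes.AbelianSchemeIsLambdaOfAtConjugate
import HarnessLib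

/-!
# Uniqueness of the Siegel class of an admissible triple ([Milne 2005] Thm. 6.11, injectivity; Lemma 5.13)

Topic `Literature/AlgebraicGeometry/ModuliOfAbelianVarieties`; namespace `Literature.AlgebraicGeometry.ModuliOfAbelianVarieties`.
Cell hodgecm-mathlib (D-0151), node U-c (i) of the decomposition of the interface statement (U)
`siegelModuli_complexUniformisation` (B-plan2 `B-plan/U-DAG.md` v0.1, brick B1): **if one polarised abelian scheme with
symplectic-liftable level-`N` structure `P′` over `Spec ℂ` is admissible (★ `IsAdmissibleAt`) both at `(Z, r)` and at
`(Z′, r)` — `N ≥ 3`, `r ∈ K_δ(1)` an integral representative — then `[J(Z), r·K_δ(N)] = [J(Z′), r·K_δ(N)]` in the Siegel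
Shimura set, equivalently `Z = M • Z′` for some `M ∈ Γ_δ(N)`.**  This is the injectivity half of «the set `Sh_K(ℂ)`
classifies the triples `(A, s, ηK)` modulo isomorphism» applied to the identity isomorphism of the fibre of `P′` with its
two markings: the rational representation `q` of `𝟙` between the two markings (★ `SiegelAdelicMarking.exists_ratRep_of_hom`)
is integral and `≡ 1 (mod N)` because both symplectic lifts restrict to the level-`N` structure (D3 `lift_level`), and it
is a rational similitude of `E_δ` because the two lifts are symplectic for the SAME Weil pairing `ē^λ` at every level
`N ∣ M` (witness-independence ★ `IsLambdaOfAt.weilPairingLevel_eq` + the `pairing` clauses, compared through the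
residue tower of `r⁻¹`, ★ `exists_similitudeTower`); `GSp_δ(ℚ) ∩ K_δ(N) = Γ_δ(N)` (★ R60-11) finishes.
THEOREMS ONLY (no definition, no named fact, no instance, no `sorry`); the (U) fact file is imported for the
predicate `IsAdmissibleAt` only — `siegelModuli_complexUniformisation` is NOT assumed.
HC_CM is proved only modulo the printed citations until rung 0 closes.

## References
* [Milne2005ShimuraVarieties] J. S. Milne, *Introduction to Shimura Varieties* (2005), §6 Thm. 6.11 pp. 74–75, Lemma 5.13
  p. 57 (footnote 40).
* [Lange2023AbelianVarietiesComplex] H. Lange, *Abelian Varieties over the Complex Numbers* (2023), §3.1.2 Prop. 3.1.4.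
* [Deligne1971TravauxShimura] P. Deligne, *Travaux de Shimura*, Sém. Bourbaki 389 (1971), 4.12 (b) p. 149, 4.16 p. 150.
* [Lan2013PELCompactifications] K.-W. Lan, *Arithmetic compactifications of PEL-type Shimura varieties* (2013), §1.3.6.
-/

set_option autoImplicit false

noncomputable section

open Matrix CategoryTheory AlgebraicGeometry
open Literature.AlgebraicGeometry.Motives (AbelianVariety AlgPoints CartierDivisor specOver)
open Literature.AlgebraicGeometry.AbelianSchemes (AbelianSchemeOver PolarizedAbelianSchemeWithLevel)
open Literature.NumberTheory.Adeles (latticeOfGL mem_latticeOfGL_one_iff latticeOfGL_mul_eq_of_mem integralAdeleResidue)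
open Literature.NumberTheory.Automorphic (siegelUpperHalfSpace)

namespace Literature.AlgebraicGeometry.ModuliOfAbelianVarieties

open SiegelModuli

variable {g : ℕ} {δ : Fin g → ℕ}

/-! ### §0. Elementary lemmas -/

section Elementary

/-- A homomorphism out of `Multiplicative ((ℤ/N)^ι)` is determined by its values on the basis vectors `eᵢ`
(`x = ∑ᵢ x̃ᵢ • eᵢ`). [folklore] -/
private theorem monoidHom_multiplicative_zmod_ext {ι : Type*} [Fintype ι] [DecidableEq ι] {N : ℕ} [NeZero N] {G : Type*}
    [CommMonoid G] (f f' : Multiplicative (ι → ZMod N) →* G)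
    (h : ∀ i, f (Multiplicative.ofAdd (Pi.single i 1)) = f' (Multiplicative.ofAdd (Pi.single i 1))) : f = f' := by
  refine MonoidHom.ext fun x => ?_
  have hsingle : ∀ i, (x.toAdd i).val • (Pi.single i (1 : ZMod N) : ι → ZMod N) = Pi.single i (x.toAdd i) := by
    intro i
    ext j
    rcases eq_or_ne j i with rfl | hj
    · simp [nsmul_eq_mul]
    · simp [hj]
  have hx : x = ∏ i, (Multiplicative.ofAdd (Pi.single i (1 : ZMod N))) ^ (x.toAdd i).val := by
    calc x = Multiplicative.ofAdd (∑ i, Pi.single i (x.toAdd i)) := by rw [Finset.univ_sum_single]; rfl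
      _ = ∏ i, Multiplicative.ofAdd (Pi.single i (x.toAdd i)) := ofAdd_sum _ _
      _ = ∏ i, (Multiplicative.ofAdd (Pi.single i (1 : ZMod N))) ^ (x.toAdd i).val :=
          Finset.prod_congr rfl fun i _ => by rw [← ofAdd_nsmul, hsingle]
  rw [hx, map_prod, map_prod]
  exact Finset.prod_congr rfl fun i _ => by rw [map_pow, map_pow, h]

/-- A rational matrix carrying EVERY rational vector to an integer vector is zero. [folklore] -/
private theorem eq_zero_of_forall_mulVec_int {n : Type*} [Fintype n] [DecidableEq n] (D : Matrix n n ℚ)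
    (h : ∀ v : n → ℚ, ∀ i, ∃ z : ℤ, (z : ℚ) = (D *ᵥ v) i) : D = 0 := by
  ext i j
  rw [Matrix.zero_apply]
  by_contra hne
  obtain ⟨z, hz⟩ := h (Pi.single j (1 / (2 * D i j))) i
  rw [Matrix.mulVec, dotProduct_single] at hz
  have h2 : (((2 * z : ℤ)) : ℚ) = 1 := by
    push_cast
    rw [hz]
    field_simp
  have h2' : (2 * z : ℤ) = 1 := by exact_mod_cast h2
  omega

/-- An integer divisible by `N·k` for every `k ≥ 1` (`N ≥ 1`) is zero. [folklore] -/
private theorem int_eq_zero_of_forall_dvd {N : ℕ} (hN : N ≠ 0) {z : ℤ} (h : ∀ k : ℕ, k ≠ 0 → ((N * k : ℕ) : ℤ) ∣ z) : z = 0 := by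
  refine Int.eq_zero_of_dvd_of_natAbs_lt_natAbs (h (z.natAbs + 1) (Nat.succ_ne_zero _)) ?_
  rw [Int.natAbs_natCast]
  have h1 : 1 ≤ N := Nat.one_le_iff_ne_zero.2 hN
  nlinarith [z.natAbs.zero_le]

/-- Two primitive `M`-th roots of unity are coprime powers of one another. [folklore] -/
private theorem exists_coprime_pow_eq_of_isPrimitiveRoot' {K : Type*} [CommRing K] [IsDomain K] {M : ℕ} (hM : M ≠ 0) {ζ₁ ζ₂ : K}
    (h₁ : IsPrimitiveRoot ζ₁ M) (h₂ : IsPrimitiveRoot ζ₂ M) : ∃ b : ℕ, b.Coprime M ∧ ζ₁ ^ b = ζ₂ := by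
  haveI : NeZero M := ⟨hM⟩
  obtain ⟨b, -, hb⟩ := h₁.eq_pow_of_pow_eq_one h₂.pow_eq_one
  refine ⟨b, ?_, hb⟩
  have := (h₁.pow_iff_coprime (Nat.pos_of_ne_zero hM) b).1 (hb ▸ h₂)
  exact this

/-- For an integer matrix `Q` and a label `x ∈ (ℤ/M)^n`: the rational vectors `Q · (x̃/M)` and `(Q̄ x)~/M` differ by an
integer vector (both numerators reduce to `Q̄ x` mod `M`). [folklore] -/
private theorem exists_int_eq_map_mulVec_val_div_sub {n : Type*} [Fintype n] [DecidableEq n] {M : ℕ} [NeZero M]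
    (Q : Matrix n n ℤ) (x : n → ZMod M) (i : n) :
    ∃ z : ℤ, (z : ℚ) = (Q.map (Int.castRingHom ℚ) *ᵥ fun j => ((x j).val : ℚ) / M) i -
      ((((Q.map (Int.castRingHom (ZMod M)) *ᵥ x) i).val : ℚ) / M) := by
  have hMQ : (M : ℚ) ≠ 0 := by exact_mod_cast NeZero.ne M
  -- the two numerators
  set S : ℤ := ∑ j, Q i j * ((x j).val : ℤ) with hS
  have hnum : (Q.map (Int.castRingHom ℚ) *ᵥ fun j => ((x j).val : ℚ) / M) i = (S : ℚ) / M := by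
    rw [Matrix.mulVec, dotProduct, hS]
    push_cast
    rw [Finset.sum_div]
    refine Finset.sum_congr rfl fun j _ => ?_
    rw [Matrix.map_apply, eq_intCast]
    ring
  have hred : ((S : ℤ) : ZMod M) = (Q.map (Int.castRingHom (ZMod M)) *ᵥ x) i := by
    rw [hS, Matrix.mulVec, dotProduct]
    push_cast
    refine Finset.sum_congr rfl fun j _ => ?_
    rw [Matrix.map_apply, eq_intCast, ZMod.natCast_zmod_val]
  have hdvd : (M : ℤ) ∣ S - (((Q.map (Int.castRingHom (ZMod M)) *ᵥ x) i).val : ℤ) := by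
    rw [← ZMod.intCast_zmod_eq_zero_iff_dvd, Int.cast_sub, hred, Int.cast_natCast, ZMod.natCast_zmod_val, sub_self]
  obtain ⟨z, hz⟩ := hdvd
  refine ⟨z, ?_⟩
  rw [hnum, div_sub_div_same]
  have : ((S : ℚ) - (((Q.map (Int.castRingHom (ZMod M)) *ᵥ x) i).val : ℚ)) = (M : ℚ) * z := by exact_mod_cast hz
  rw [this, mul_div_cancel_left₀ _ hMQ]

end Elementary

/-! ### §1. Two symplectic lifts of one level structure, two markings of one fibre by `[J, r]`, `[J′, r]` -/

section TwoMarkings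

variable {N : ℕ} {S : Scheme} {B : AbelianSchemeOver S} {s : Spec (.of ℂ) ⟶ S} {φ : B.LevelStructure g N}
  {Θ Θ' : CartierDivisor (B.fibre s).toAbelianVariety.X.left}
  {J J' : C0pm δ} {r : gspFinAdelic δ}

/-- **Two symplectic lifts of the same level-`N` structure agree at level `N`** (both restrict to the level sections,
D3 `lift_level`; the lifts may be taken for different witnesses `Θ, Θ′` and different root systems).
[cite: Lan2013PELCompactifications, §1.3.6 Def. 1.3.6.2 (p. 80)] -/
theorem coe_symplecticLift_level_eq [NeZero N] (Λ : φ.SymplecticLift s Θ δ) (Λ' : φ.SymplecticLift s Θ' δ)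
    (y : Fin g ⊕ Fin g → ZMod N) :
    ((Λ.lift N (Multiplicative.ofAdd y)) : (B.fibre s).toAbelianVariety.Points ℂ) =
      Λ'.lift N (Multiplicative.ofAdd y) := by
  have key : ((B.fibre s).toAbelianVariety.torsionPoints ℂ (N : ℤ)).subtype.comp (Λ.lift N) =
      ((B.fibre s).toAbelianVariety.torsionPoints ℂ (N : ℤ)).subtype.comp (Λ'.lift N) :=
    monoidHom_multiplicative_zmod_ext _ _ fun i => by
      simp only [MonoidHom.comp_apply, Subgroup.subtype_apply]
      rw [Λ.lift_level i, Λ'.lift_level i]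
  exact DFunLike.congr_fun key (Multiplicative.ofAdd y)

/-- For an integral representative `r ∈ K_δ(1) = GSp_δ(ℤ̂)` the lattice of the marking is the standard one:
`Λ_r = ℚ^{2g} ∩ r·ℤ̂^{2g} = ℤ^{2g}`. [cite: Milne2005ShimuraVarieties, §4 pp. 48–49 and Lemma 5.13 p. 57] -/
theorem latticeOfGL_coe_eq_one_of_mem_principalLevelSubgroup_one (hr : r ∈ principalLevelSubgroup δ 1) :
    latticeOfGL ((r : gspFinAdelic δ) : GL (Fin g ⊕ Fin g) finAdeleQ) = latticeOfGL (1 : GL (Fin g ⊕ Fin g) finAdeleQ) := by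
  rw [← one_mul ((r : gspFinAdelic δ) : GL (Fin g ⊕ Fin g) finAdeleQ)]
  exact latticeOfGL_mul_eq_of_mem 1 (coe_mem_units_matrix_integralFiniteAdeles_of_mem_principalLevelSubgroup_one hr)

/-- **Two markings of one fibre by `[J, r]` and `[J′, r]`, each matched to a symplectic lift of the SAME level-`N`
structure, agree on the `N`-torsion**: `u(x̃/N) = u′(x̃/N)` for every label `x ∈ (ℤ/N)^{2g}` — read both tower clauses at
the relabelled class `Γ_N x` of the residue tower of `r⁻¹` (★ `exists_similitudeTower`,
★ `adelicCongr_val_div_of_entries_residue`) and use `coe_symplecticLift_level_eq`.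
[cite: Milne2005ShimuraVarieties, §6 Thm. 6.11 p. 75 («ηK ↦ η′K»)] [cite: Deligne1971TravauxShimura, 4.16 p. 150] -/
theorem r_val_div_eq_of_lifts (hδ : IsPolarizationType δ) (hg : 0 < g) [NeZero N]
    (hr : r ∈ principalLevelSubgroup δ 1)
    (Λ : φ.SymplecticLift s Θ δ) (m : SiegelAdelicMarking J r (B.fibre s).toAbelianVariety)
    (hΛ : ∀ ⦃M : ℕ⦄, N ∣ M → M ≠ 0 → ∀ (x : Fin g ⊕ Fin g → ZMod M) (v : Fin g ⊕ Fin g → ℚ),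
      AdelicCongr ((r⁻¹ : gspFinAdelic δ) : GL (Fin g ⊕ Fin g) finAdeleQ) 1 v (fun i => ((x i).val : ℚ) / M) →
        ((Λ.lift M (Multiplicative.ofAdd x)) : (B.fibre s).toAbelianVariety.Points ℂ) = m.r v)
    (Λ' : φ.SymplecticLift s Θ' δ) (m' : SiegelAdelicMarking J' r (B.fibre s).toAbelianVariety)
    (hΛ' : ∀ ⦃M : ℕ⦄, N ∣ M → M ≠ 0 → ∀ (x : Fin g ⊕ Fin g → ZMod M) (v : Fin g ⊕ Fin g → ℚ),
      AdelicCongr ((r⁻¹ : gspFinAdelic δ) : GL (Fin g ⊕ Fin g) finAdeleQ) 1 v (fun i => ((x i).val : ℚ) / M) →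
        ((Λ'.lift M (Multiplicative.ofAdd x)) : (B.fibre s).toAbelianVariety.Points ℂ) = m'.r v)
    (x : Fin g ⊕ Fin g → ZMod N) :
    m.r (fun i => ((x i).val : ℚ) / N) = m'.r (fun i => ((x i).val : ℚ) / N) := by
  obtain ⟨Γ, ν, hΓres, -, -, -⟩ := exists_similitudeTower δ hδ hg (inv_mem hr : r⁻¹ ∈ principalLevelSubgroup δ 1)
  have hc := adelicCongr_val_div_of_entries_residue (inv_mem hr : r⁻¹ ∈ principalLevelSubgroup δ 1)
    ((Γ N : GL (Fin g ⊕ Fin g) (ZMod N)) : Matrix (Fin g ⊕ Fin g) (Fin g ⊕ Fin g) (ZMod N)) (hΓres N) x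
  rw [← hΛ (dvd_refl N) (NeZero.ne N) _ _ hc, ← hΛ' (dvd_refl N) (NeZero.ne N) _ _ hc]
  exact coe_symplecticLift_level_eq Λ Λ' _

/-- **The rational representation of the identity between the two markings is integral and `≡ 1 (mod N)`.**  If
`u(v) = u′(q v)` for all `v` (★ `SiegelAdelicMarking.exists_ratRep_of_hom` for `𝟙`), then `q ∈ 1 + N·M_{2g}(ℤ)`:
the class `eⱼ/N` is read alike by `u` and `u′` (`r_val_div_eq_of_lifts`), so `q(eⱼ/N) − eⱼ/N ∈ Λ_r = ℤ^{2g}`.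
[cite: Milne2005ShimuraVarieties, Lemma 5.13 p. 57 (footnote 40, «we find that q ∈ Γ»)] [cite: Deligne1971TravauxShimura, 4.16 p. 150] -/
theorem exists_intMatrix_of_ratRep_of_lifts (hδ : IsPolarizationType δ) (hg : 0 < g) [NeZero N] (hN1 : 1 < N)
    (hr : r ∈ principalLevelSubgroup δ 1)
    (Λ : φ.SymplecticLift s Θ δ) (m : SiegelAdelicMarking J r (B.fibre s).toAbelianVariety)
    (hΛ : ∀ ⦃M : ℕ⦄, N ∣ M → M ≠ 0 → ∀ (x : Fin g ⊕ Fin g → ZMod M) (v : Fin g ⊕ Fin g → ℚ),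
      AdelicCongr ((r⁻¹ : gspFinAdelic δ) : GL (Fin g ⊕ Fin g) finAdeleQ) 1 v (fun i => ((x i).val : ℚ) / M) →
        ((Λ.lift M (Multiplicative.ofAdd x)) : (B.fibre s).toAbelianVariety.Points ℂ) = m.r v)
    (Λ' : φ.SymplecticLift s Θ' δ) (m' : SiegelAdelicMarking J' r (B.fibre s).toAbelianVariety)
    (hΛ' : ∀ ⦃M : ℕ⦄, N ∣ M → M ≠ 0 → ∀ (x : Fin g ⊕ Fin g → ZMod M) (v : Fin g ⊕ Fin g → ℚ),
      AdelicCongr ((r⁻¹ : gspFinAdelic δ) : GL (Fin g ⊕ Fin g) finAdeleQ) 1 v (fun i => ((x i).val : ℚ) / M) →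
        ((Λ'.lift M (Multiplicative.ofAdd x)) : (B.fibre s).toAbelianVariety.Points ℂ) = m'.r v)
    {q : Matrix (Fin g ⊕ Fin g) (Fin g ⊕ Fin g) ℚ} (hq : ∀ v, m.r v = m'.r (q *ᵥ v)) :
    ∃ Q : Matrix (Fin g ⊕ Fin g) (Fin g ⊕ Fin g) ℤ,
      Q.map (Int.castRingHom ℚ) = q ∧ Q.map (Int.castRingHom (ZMod N)) = 1 := by
  haveI : Fact (1 < N) := ⟨hN1⟩
  have hNQ : (N : ℚ) ≠ 0 := by exact_mod_cast NeZero.ne N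
  -- the class `e_j / N` and its two readings
  have hint : ∀ i j, ∃ z : ℤ, (z : ℚ) = (q i j - (1 : Matrix (Fin g ⊕ Fin g) (Fin g ⊕ Fin g) ℚ) i j) / N := by
    intro i j
    set c : Fin g ⊕ Fin g → ℚ := fun k => (((Pi.single j (1 : ZMod N) : Fin g ⊕ Fin g → ZMod N) k).val : ℚ) / N
      with hc
    have hcj : c = fun k => (Pi.single j (1 : ℚ) : Fin g ⊕ Fin g → ℚ) k / N := by
      funext k
      rw [hc]
      rcases eq_or_ne k j with rfl | hk
      · simp [ZMod.val_one]
      · simp [hk]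
    have h1 : m'.r (q *ᵥ c) = m'.r c := by rw [← hq c, hc, r_val_div_eq_of_lifts hδ hg hr Λ m hΛ Λ' m' hΛ']
    have h2 := (m'.r_eq_r_iff_sub_mem_latticeOfGL (q *ᵥ c) c).1 h1
    rw [latticeOfGL_coe_eq_one_of_mem_principalLevelSubgroup_one hr, mem_latticeOfGL_one_iff] at h2
    obtain ⟨z, hz⟩ := h2 i
    refine ⟨z, ?_⟩
    rw [hz, Pi.sub_apply, hcj, Matrix.mulVec, dotProduct]
    simp only [Pi.single_apply, Matrix.one_apply]
    rw [Finset.sum_eq_single j (fun k _ hk => by simp [hk]) (fun h => (h (Finset.mem_univ j)).elim)]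
    simp only [if_true]
    rcases eq_or_ne i j with rfl | hij
    · simp; ring
    · simp [hij]; ring
  choose Z hZ using hint
  refine ⟨(N : ℤ) • Matrix.of Z + 1, ?_, ?_⟩
  · ext i j
    have h := hZ i j
    rw [eq_div_iff hNQ] at h
    simp only [Matrix.map_apply, Matrix.add_apply, Matrix.smul_apply, Matrix.of_apply, smul_eq_mul, map_add,
      map_mul, map_natCast, eq_intCast]
    rcases eq_or_ne i j with rfl | hij
    · simp only [Matrix.one_apply_eq, Int.cast_one] at h ⊢
      linarith
    · simp only [Matrix.one_apply_ne hij, Int.cast_zero] at h ⊢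
      linarith
  · rw [Matrix.map_add (Int.castRingHom (ZMod N)) (map_add _), Matrix.map_one _ (map_zero _) (map_one _)]
    have h0 : ((N : ℤ) • Matrix.of Z).map (Int.castRingHom (ZMod N)) = 0 := by
      ext i j
      simp
    rw [h0, zero_add]

/-- Matrix-coefficient bookkeeping: `(Q eᵢ) · E (Q eⱼ) = (ᵗQ E Q)ᵢⱼ`. [folklore] -/
private theorem mulVec_single_dotProduct_mulVec {n R : Type*} [Fintype n] [DecidableEq n] [CommRing R]
    (Q E : Matrix n n R) (i j : n) :
    (Q *ᵥ Pi.single i 1) ⬝ᵥ (E *ᵥ (Q *ᵥ Pi.single j 1)) = (Qᵀ * E * Q) i j := by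
  have h1 : Q *ᵥ Pi.single i (1 : R) = fun a => Q a i := by
    funext a; rw [Matrix.mulVec, dotProduct_single, mul_one]
  have h2 : Q *ᵥ Pi.single j (1 : R) = fun a => Q a j := by
    funext a; rw [Matrix.mulVec, dotProduct_single, mul_one]
  rw [h1, h2, Matrix.mul_assoc, Matrix.mul_apply]
  simp only [Matrix.transpose_apply, Matrix.mul_apply, dotProduct, Matrix.mulVec]

/-- `eᵢ · E eⱼ = Eᵢⱼ`. [folklore] -/
private theorem single_dotProduct_mulVec_single {n R : Type*} [Fintype n] [DecidableEq n] [CommRing R]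
    (E : Matrix n n R) (i j : n) :
    (Pi.single i (1 : R)) ⬝ᵥ (E *ᵥ Pi.single j 1) = E i j := by
  rw [single_dotProduct, one_mul, Matrix.mulVec, dotProduct_single, mul_one]

/-- **THE SIMILITUDE STEP.**  In the setting of `exists_intMatrix_of_ratRep_of_lifts`, if moreover the two witnesses
`Θ, Θ′` have the SAME level Weil pairings at every level `N ∣ M` (★ `IsLambdaOfAt.weilPairingLevel_eq`: both witness the
one polarisation), then the integral rational representative `Q` of `𝟙` is a rational SIMILITUDE of `E_δ`:
`δ₀ • ᵗQ E_δ Q = (ᵗQ E_δ Q)₀ • E_δ` (`δ₀ = (E_δ)_{0,g}`).  Proof: at level `M` the two towers are related by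
`Λ_M(Γ_M x) = Λ′_M(Γ_M Q̄ x)` (`Γ_M = r⁻¹ mod M`, ★ `exists_similitudeTower`), so the two `pairing` clauses give
`E_δ(x, y) ≡ b_M · E_δ(Q̄x, Q̄y) (mod M)` with `ζ′_M = ζ_M^{b_M}`; an integer congruence modulo every multiple of `N`
is an equality. [cite: Milne2005ShimuraVarieties, §6 Thm. 6.11 pp. 74–75 («ψ ↦ a multiple of ψ′ by η»)]
[cite: Lange2023AbelianVarietiesComplex, §3.1.2 Prop. 3.1.4] [cite: Deligne1971TravauxShimura, 4.12 (b) p. 149] -/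
theorem smul_transpose_mul_typeForm_mul_eq_of_lifts (hδ : IsPolarizationType δ) (hg : 0 < g) (hN : N ≠ 0)
    (hr : r ∈ principalLevelSubgroup δ 1)
    (Λ : φ.SymplecticLift s Θ δ) (m : SiegelAdelicMarking J r (B.fibre s).toAbelianVariety)
    (hΛ : ∀ ⦃M : ℕ⦄, N ∣ M → M ≠ 0 → ∀ (x : Fin g ⊕ Fin g → ZMod M) (v : Fin g ⊕ Fin g → ℚ),
      AdelicCongr ((r⁻¹ : gspFinAdelic δ) : GL (Fin g ⊕ Fin g) finAdeleQ) 1 v (fun i => ((x i).val : ℚ) / M) →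
        ((Λ.lift M (Multiplicative.ofAdd x)) : (B.fibre s).toAbelianVariety.Points ℂ) = m.r v)
    (Λ' : φ.SymplecticLift s Θ' δ) (m' : SiegelAdelicMarking J' r (B.fibre s).toAbelianVariety)
    (hΛ' : ∀ ⦃M : ℕ⦄, N ∣ M → M ≠ 0 → ∀ (x : Fin g ⊕ Fin g → ZMod M) (v : Fin g ⊕ Fin g → ℚ),
      AdelicCongr ((r⁻¹ : gspFinAdelic δ) : GL (Fin g ⊕ Fin g) finAdeleQ) 1 v (fun i => ((x i).val : ℚ) / M) →
        ((Λ'.lift M (Multiplicative.ofAdd x)) : (B.fibre s).toAbelianVariety.Points ℂ) = m'.r v)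
    (hpair : ∀ ⦃M : ℕ⦄ [IsDominant (AbelianVariety.Hom.toSchemeHom (((M : ℕ) : ℤ) • 𝟙 (B.fibre s).toAbelianVariety))]
      (P P' : (B.fibre s).toAbelianVariety.torsionPoints ℂ (M : ℤ)),
      (B.fibre s).toAbelianVariety.weilPairingLevel Θ P P' = (B.fibre s).toAbelianVariety.weilPairingLevel Θ' P P')
    {Q : Matrix (Fin g ⊕ Fin g) (Fin g ⊕ Fin g) ℤ} (hq : ∀ v, m.r v = m'.r (Q.map (Int.castRingHom ℚ) *ᵥ v)) :
    (typeForm δ (Sum.inl ⟨0, hg⟩) (Sum.inr ⟨0, hg⟩)) • (Qᵀ * typeForm δ * Q) =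
      ((Qᵀ * typeForm δ * Q) (Sum.inl ⟨0, hg⟩) (Sum.inr ⟨0, hg⟩)) • typeForm δ := by
  obtain ⟨Γ, ν, hΓres, -, -, hΓsim⟩ := exists_similitudeTower δ hδ hg (inv_mem hr : r⁻¹ ∈ principalLevelSubgroup δ 1)
  set F : Matrix (Fin g ⊕ Fin g) (Fin g ⊕ Fin g) ℤ := Qᵀ * typeForm δ * Q with hF
  -- Step 1: at every level `M = N·k` the reductions of `E_δ` and `F` are proportional
  have hlevel : ∀ k : ℕ, k ≠ 0 → ∃ b : ZMod (N * k),
      (typeForm δ).map (Int.castRingHom (ZMod (N * k))) = b • F.map (Int.castRingHom (ZMod (N * k))) := by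
    intro k hk
    have hM0 : N * k ≠ 0 := mul_ne_zero hN hk
    haveI : NeZero (N * k) := ⟨hM0⟩
    have hNM : N ∣ N * k := Dvd.intro k rfl
    have hMℂ : ((N * k : ℕ) : ℂ) ≠ 0 := by exact_mod_cast hM0
    haveI := AbelianVariety.isDominant_toSchemeHom_zsmul_of_ne_zero (B.fibre s).toAbelianVariety hMℂ
    set ΓM : Matrix (Fin g ⊕ Fin g) (Fin g ⊕ Fin g) (ZMod (N * k)) :=
      ((Γ (N * k) : GL (Fin g ⊕ Fin g) (ZMod (N * k))) : Matrix (Fin g ⊕ Fin g) (Fin g ⊕ Fin g) (ZMod (N * k)))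
      with hΓM
    set Qb : Matrix (Fin g ⊕ Fin g) (Fin g ⊕ Fin g) (ZMod (N * k)) := Q.map (Int.castRingHom (ZMod (N * k))) with hQb
    -- (**) the two towers compared through `q`
    have hstar : ∀ x : Fin g ⊕ Fin g → ZMod (N * k),
        Λ.lift (N * k) (Multiplicative.ofAdd (ΓM *ᵥ x)) =
          Λ'.lift (N * k) (Multiplicative.ofAdd (ΓM *ᵥ (Qb *ᵥ x))) := by
      intro x
      apply Subtype.ext
      have hc := adelicCongr_val_div_of_entries_residue (inv_mem hr : r⁻¹ ∈ principalLevelSubgroup δ 1) ΓM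
        (hΓres (N * k)) x
      have hc' := adelicCongr_val_div_of_entries_residue (inv_mem hr : r⁻¹ ∈ principalLevelSubgroup δ 1) ΓM
        (hΓres (N * k)) (Qb *ᵥ x)
      rw [hΛ hNM hM0 _ _ hc, hΛ' hNM hM0 _ _ hc', hq]
      refine (m'.r_eq_r_iff_sub_mem_latticeOfGL _ _).2 ?_
      rw [latticeOfGL_coe_eq_one_of_mem_principalLevelSubgroup_one hr, mem_latticeOfGL_one_iff]
      intro i
      simpa only [Pi.sub_apply] using exists_int_eq_map_mulVec_val_div_sub Q x i
    -- the two root systems at level `M`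
    have hζ := Λ.isPrimitiveRoot_ζ hNM hM0
    obtain ⟨b, -, hb⟩ := exists_coprime_pow_eq_of_isPrimitiveRoot' hM0 hζ (Λ'.isPrimitiveRoot_ζ hNM hM0)
    -- the pairing identity `E(x, y) = b · E(Q̄x, Q̄y)` in `ℤ/M`
    have hexp : ∀ x y : Fin g ⊕ Fin g → ZMod (N * k),
        AbelianSchemeOver.typeFormMod δ (N * k) x y =
          (b : ZMod (N * k)) * AbelianSchemeOver.typeFormMod δ (N * k) (Qb *ᵥ x) (Qb *ᵥ y) := by
      intro x y
      have e1 := Λ.weilPairingLevel_lift hNM hMℂ (ΓM *ᵥ x) (ΓM *ᵥ y)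
      have e2 := Λ'.weilPairingLevel_lift hNM hMℂ (ΓM *ᵥ (Qb *ᵥ x)) (ΓM *ᵥ (Qb *ᵥ y))
      rw [hstar x, hstar y, hpair, e2, hΓsim hM0, hΓsim hM0, ← hb, ← pow_mul] at e1
      -- `e1 : ζ ^ (b * (ν E(Q̄x,Q̄y)).val) = ζ ^ (ν E(x,y)).val`
      have hmod : Λ.ζ (N * k) ^ (b * ((ν (N * k) : ZMod (N * k)) *
          AbelianSchemeOver.typeFormMod δ (N * k) (Qb *ᵥ x) (Qb *ᵥ y)).val) =
          Λ.ζ (N * k) ^ ((b * ((ν (N * k) : ZMod (N * k)) *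
            AbelianSchemeOver.typeFormMod δ (N * k) (Qb *ᵥ x) (Qb *ᵥ y)).val) % (N * k)) := by
        conv_lhs => rw [← Nat.mod_add_div (b * ((ν (N * k) : ZMod (N * k)) *
          AbelianSchemeOver.typeFormMod δ (N * k) (Qb *ᵥ x) (Qb *ᵥ y)).val) (N * k), pow_add, pow_mul,
          hζ.pow_eq_one, one_pow, mul_one]
      rw [hmod] at e1
      have hval := hζ.pow_inj (Nat.mod_lt _ (Nat.pos_of_ne_zero hM0)) (ZMod.val_lt _) e1
      have hz : (b : ZMod (N * k)) * ((ν (N * k) : ZMod (N * k)) *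
          AbelianSchemeOver.typeFormMod δ (N * k) (Qb *ᵥ x) (Qb *ᵥ y)) =
          (ν (N * k) : ZMod (N * k)) * AbelianSchemeOver.typeFormMod δ (N * k) x y := by
        have := congrArg (fun t : ℕ => (t : ZMod (N * k))) hval
        simpa only [ZMod.natCast_mod, Nat.cast_mul, ZMod.natCast_zmod_val] using this
      calc AbelianSchemeOver.typeFormMod δ (N * k) x y
          = (((ν (N * k))⁻¹ : (ZMod (N * k))ˣ) : ZMod (N * k)) *
              ((ν (N * k) : ZMod (N * k)) * AbelianSchemeOver.typeFormMod δ (N * k) x y) := by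
            rw [Units.inv_mul_cancel_left]
        _ = (((ν (N * k))⁻¹ : (ZMod (N * k))ˣ) : ZMod (N * k)) * ((b : ZMod (N * k)) *
              ((ν (N * k) : ZMod (N * k)) * AbelianSchemeOver.typeFormMod δ (N * k) (Qb *ᵥ x) (Qb *ᵥ y))) := by
            rw [hz]
        _ = (b : ZMod (N * k)) * AbelianSchemeOver.typeFormMod δ (N * k) (Qb *ᵥ x) (Qb *ᵥ y) := by
            rw [mul_left_comm, Units.inv_mul_cancel_left]
    refine ⟨b, ?_⟩
    ext i j
    have hij := hexp (Pi.single i 1) (Pi.single j 1)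
    rw [typeFormMod_eq_dotProduct, typeFormMod_eq_dotProduct, single_dotProduct_mulVec_single,
      mulVec_single_dotProduct_mulVec] at hij
    rw [Matrix.smul_apply, smul_eq_mul, hF, Matrix.map_mul, Matrix.map_mul, Matrix.transpose_map]
    exact hij
  -- Step 2: an integer congruence modulo every `N·k` is an equality
  ext i j
  rw [Matrix.smul_apply, Matrix.smul_apply, smul_eq_mul, smul_eq_mul]
  have hz : typeForm δ i j * F (Sum.inl ⟨0, hg⟩) (Sum.inr ⟨0, hg⟩) -
      typeForm δ (Sum.inl ⟨0, hg⟩) (Sum.inr ⟨0, hg⟩) * F i j = 0 := by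
    refine int_eq_zero_of_forall_dvd hN fun k hk => ?_
    obtain ⟨b, hb⟩ := hlevel k hk
    have hE : ∀ a c, ((typeForm δ a c : ℤ) : ZMod (N * k)) = b * ((F a c : ℤ) : ZMod (N * k)) := fun a c => by
      have := congrFun (congrFun hb a) c
      simpa only [Matrix.map_apply, Matrix.smul_apply, smul_eq_mul, eq_intCast] using this
    rw [← ZMod.intCast_zmod_eq_zero_iff_dvd]
    push_cast
    rw [hE i j, hE (Sum.inl ⟨0, hg⟩) (Sum.inr ⟨0, hg⟩)]
    ring
  linear_combination -hz

end TwoMarkings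

/-! ### §2. The Siegel class of an admissible triple is unique -/

section Main

variable {N : ℕ} {r : gspFinAdelic δ} {Z Z' : Matrix (Fin g) (Fin g) ℂ}

/-- **HEAD — [Milne 2005, Thm. 6.11] injectivity on ONE triple / [Milne 2005, Lemma 5.13]: the Siegel class of an
admissible triple is unique.**  For `0 < g`, a polarisation type `δ`, `N ≥ 3`, an integral representative `r ∈ K_δ(1)`
and `Z, Z′ ∈ 𝔥_g`: if ONE polarised abelian scheme with level-`N` structure `P′` over `Spec ℂ` is admissible
(★ `IsAdmissibleAt`) both at `(Z, r)` and at `(Z′, r)`, then `[J(Z), r·K_δ(N)] = [J(Z′), r·K_δ(N)]` in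
`Sh_{K_δ(N)}(GSp_δ, S^±)`.  Proof: the rational representation `q` of `𝟙` between the two markings
(★ `SiegelAdelicMarking.exists_ratRep_of_hom`: `u = u′ ∘ q`, `q_ℝ J(Z) = J(Z′) q_ℝ`) and its inverse are integral and
`≡ 1 (mod N)` (`exists_intMatrix_of_ratRep_of_lifts`), `q` is a rational similitude of `E_δ`
(`smul_transpose_mul_typeForm_mul_eq_of_lifts`, fed by ★ `IsLambdaOfAt.weilPairingLevel_eq`), so `q ∈ GSp_δ(ℚ)` with
`q̂ ∈ K_δ(N)` and `q·J(Z)·q⁻¹ = J(Z′)` — the criterion ★ `SiegelShimuraSet.mk_eq_mk_iff_of_mem_one`.  Road note (cell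
hodgecm-mathlib, U-DAG brick B1): the integrality comes from `q Λ_r = Λ_r` in `latticeOfGL` currency — no `ẑ`-tower is
assembled (the alternative census L1 of B-p18 (g13); its L2 + L3 = §1 + §2 here).
[cite: Milne2005ShimuraVarieties, §6 Thm. 6.11 pp. 74–75, Lemma 5.13 p. 57 (footnote 40)]
[cite: Deligne1971TravauxShimura, 4.16 p. 150] [cite: Lange2023AbelianVarietiesComplex, §3.1.2 Prop. 3.1.4] -/
theorem siegelShimuraSet_mk_eq_of_isAdmissibleAt (hg : 0 < g) (hδ : IsPolarizationType δ) (hN : 3 ≤ N)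
    (hr : r ∈ principalLevelSubgroup δ 1) (hZ : Z ∈ siegelUpperHalfSpace g) (hZ' : Z' ∈ siegelUpperHalfSpace g)
    (P' : PolarizedAbelianSchemeWithLevel g N δ (specOver ℚ ℂ).left)
    (h : IsAdmissibleAt hδ r Z hZ P') (h' : IsAdmissibleAt hδ r Z' hZ' P') :
    SiegelShimuraSet.mk δ (principalLevelSubgroup δ N)
        ⟨jOfSiegel δ Z, SiegelComplexRecordSystem.jOfSiegel_mem_C0pm hδ.1 hZ⟩ r =
      SiegelShimuraSet.mk δ (principalLevelSubgroup δ N)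
        ⟨jOfSiegel δ Z', SiegelComplexRecordSystem.jOfSiegel_mem_C0pm hδ.1 hZ'⟩ r := by
  have hN0 : N ≠ 0 := by omega
  haveI : NeZero N := ⟨hN0⟩
  have hN1 : 1 < N := by omega
  obtain ⟨m, Θ, Λ, -, hΘl, hΛ⟩ := h
  obtain ⟨m', Θ', Λ', -, hΘl', hΛ'⟩ := h'
  -- (1) the rational representations of `𝟙` between the two markings, in both directions
  obtain ⟨q, hq0, hqJ⟩ := m.exists_ratRep_of_hom m' (𝟙 _)
  obtain ⟨q', hq0', -⟩ := m'.exists_ratRep_of_hom m (𝟙 _)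
  have hq : ∀ v, m.r v = m'.r (q *ᵥ v) := fun v => by
    have h := hq0 v
    simp only [AbelianVariety.id_hom] at h
    exact h
  have hq' : ∀ v, m'.r v = m.r (q' *ᵥ v) := fun v => by
    have h := hq0' v
    simp only [AbelianVariety.id_hom] at h
    exact h
  -- (2) integrality: `q, q′ ∈ 1 + N·M_{2g}(ℤ)`
  obtain ⟨Q, hQq, hQ1⟩ := exists_intMatrix_of_ratRep_of_lifts hδ hg hN1 hr Λ m hΛ Λ' m' hΛ' hq
  obtain ⟨Q', hQ'q, hQ'1⟩ := exists_intMatrix_of_ratRep_of_lifts hδ hg hN1 hr Λ' m' hΛ' Λ m hΛ hq'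
  -- `q′ q = 1 = q q′`: `(q′q − 1) v ∈ Λ_r = ℤ^{2g}` for EVERY rational `v`
  have hlat := latticeOfGL_coe_eq_one_of_mem_principalLevelSubgroup_one hr
  have hq'q : q' * q = 1 := by
    rw [← sub_eq_zero]
    refine eq_zero_of_forall_mulVec_int _ fun v => ?_
    have h1 : m.r (q' *ᵥ (q *ᵥ v)) = m.r v := by rw [← hq', ← hq]
    have h2 := (m.r_eq_r_iff_sub_mem_latticeOfGL _ _).1 h1
    rw [hlat, mem_latticeOfGL_one_iff] at h2
    simpa only [Matrix.sub_mulVec, Matrix.one_mulVec, ← Matrix.mulVec_mulVec] using h2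
  have hqq' : q * q' = 1 := by
    rw [← sub_eq_zero]
    refine eq_zero_of_forall_mulVec_int _ fun v => ?_
    have h1 : m'.r (q *ᵥ (q' *ᵥ v)) = m'.r v := by rw [← hq, ← hq']
    have h2 := (m'.r_eq_r_iff_sub_mem_latticeOfGL _ _).1 h1
    rw [hlat, mem_latticeOfGL_one_iff] at h2
    simpa only [Matrix.sub_mulVec, Matrix.one_mulVec, ← Matrix.mulVec_mulVec] using h2
  set qGL : GL (Fin g ⊕ Fin g) ℚ := ⟨q, q', hqq', hq'q⟩ with hqGL
  -- (3) `q` is a rational similitude of `E_δ`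
  have hpair : ∀ ⦃M : ℕ⦄
      [IsDominant (AbelianVariety.Hom.toSchemeHom (((M : ℕ) : ℤ) • 𝟙 (P'.A.fibre (𝟙 _)).toAbelianVariety))]
      (P₁ P₂ : (P'.A.fibre (𝟙 _)).toAbelianVariety.torsionPoints ℂ (M : ℤ)),
      (P'.A.fibre (𝟙 _)).toAbelianVariety.weilPairingLevel Θ P₁ P₂ =
        (P'.A.fibre (𝟙 _)).toAbelianVariety.weilPairingLevel Θ' P₁ P₂ :=
    fun M _ P₁ P₂ => AbelianSchemeOver.IsLambdaOfAt.weilPairingLevel_eq P'.A P'.D P'.pol.lam (𝟙 _) hΘl hΘl' P₁ P₂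
  have hqQ : ∀ v, m.r v = m'.r (Q.map (Int.castRingHom ℚ) *ᵥ v) := by rw [hQq]; exact hq
  have hF := smul_transpose_mul_typeForm_mul_eq_of_lifts hδ hg hN0 hr Λ m hΛ Λ' m' hΛ' hpair hqQ
  set d : ℤ := typeForm δ (Sum.inl ⟨0, hg⟩) (Sum.inr ⟨0, hg⟩) with hd
  set F : Matrix (Fin g ⊕ Fin g) (Fin g ⊕ Fin g) ℤ := Qᵀ * typeForm δ * Q with hFdef
  have hd0 : d ≠ 0 := by
    rw [hd, typeForm, Matrix.fromBlocks_apply₁₂, Matrix.diagonal_apply_eq]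
    exact Nat.cast_ne_zero.2 (hδ.1 ⟨0, hg⟩).ne'
  -- `det F ≠ 0`, so the proportionality factor is non-zero
  have hQQ' : Q * Q' = 1 := by
    have hinj : Function.Injective (fun X : Matrix (Fin g ⊕ Fin g) (Fin g ⊕ Fin g) ℤ => X.map (Int.castRingHom ℚ)) :=
      fun X Y hXY => by
        ext i j
        have := congrFun (congrFun hXY i) j
        simpa using this
    apply hinj
    simp only [Matrix.map_mul, hQq, hQ'q, hqq', Matrix.map_one (Int.castRingHom ℚ) (map_zero _) (map_one _)]
  have hdetQ : Q.det ≠ 0 := by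
    intro h0
    have := congrArg Matrix.det hQQ'
    rw [Matrix.det_mul, h0, zero_mul, Matrix.det_one] at this
    exact zero_ne_one this
  have hdetE : (typeForm δ).det ≠ 0 := by
    intro h0
    apply det_typeFormOver_rat_ne_zero hδ.1
    rw [typeFormOver, ← RingHom.mapMatrix_apply, ← RingHom.map_det, h0, map_zero]
  have hF0 : F (Sum.inl ⟨0, hg⟩) (Sum.inr ⟨0, hg⟩) ≠ 0 := by
    intro h0
    rw [h0, zero_smul, smul_eq_zero] at hF
    rcases hF with h1 | h1
    · exact hd0 h1
    · haveI : Nonempty (Fin g ⊕ Fin g) := ⟨Sum.inl ⟨0, hg⟩⟩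
      have := congrArg Matrix.det h1
      rw [Matrix.det_mul, Matrix.det_mul, Matrix.det_transpose, Matrix.det_zero] at this
      exact mul_ne_zero (mul_ne_zero hdetQ hdetE) hdetQ this
  set ν : ℚ := (F (Sum.inl ⟨0, hg⟩) (Sum.inr ⟨0, hg⟩) : ℚ) / d with hν
  have hν0 : ν ≠ 0 := div_ne_zero (Int.cast_ne_zero.2 hF0) (Int.cast_ne_zero.2 hd0)
  have hdQ : (d : ℚ) ≠ 0 := Int.cast_ne_zero.2 hd0
  have hsim : IsMultiplier (typeFormOver δ ℚ) qGL (Units.mk0 ν hν0) := by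
    rw [isMultiplier_iff, Units.val_mk0]
    change qᵀ * typeFormOver δ ℚ * q = ν • typeFormOver δ ℚ
    rw [← hQq, typeFormOver, ← Matrix.transpose_map, ← Matrix.map_mul, ← Matrix.map_mul]
    ext i j
    have hij := congrFun (congrFun hF i) j
    simp only [Matrix.smul_apply, smul_eq_mul] at hij
    rw [Matrix.map_apply, Matrix.smul_apply, Matrix.map_apply, smul_eq_mul, hν, eq_intCast, eq_intCast,
      div_mul_eq_mul_div, eq_div_iff hdQ]
    exact_mod_cast (mul_comm _ _).trans hij
  set γ : gspRational δ := ⟨qGL, Units.mk0 ν hν0, hsim⟩ with hγ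
  -- (4) `q̂, q̂⁻¹ ≡ 1 (mod N)`: the adelic point of `q` lies in `K_δ(N)`
  have hK : gspRationalToFinAdelic δ γ ∈ principalLevelSubgroup δ N := by
    rw [mem_principalLevelSubgroup_iff]
    constructor
    · have e : (((gspRationalToFinAdelic δ γ : gspFinAdelic δ) : GL (Fin g ⊕ Fin g) finAdeleQ) :
          Matrix (Fin g ⊕ Fin g) (Fin g ⊕ Fin g) finAdeleQ) = Q.map (Int.castRingHom finAdeleQ) := by
        rw [coe_gspRationalToFinAdelic, ← map_intCast_map_algebraMap Q, hQq]; rfl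
      rw [e]; exact (isCongOne_map_intCast_iff hN0 Q).2 hQ1
    · have e : ((((gspRationalToFinAdelic δ γ : gspFinAdelic δ) : GL (Fin g ⊕ Fin g) finAdeleQ)⁻¹ :
          GL (Fin g ⊕ Fin g) finAdeleQ) : Matrix (Fin g ⊕ Fin g) (Fin g ⊕ Fin g) finAdeleQ) =
          Q'.map (Int.castRingHom finAdeleQ) := by
        rw [coe_gspRationalToFinAdelic, ← map_inv, ← map_intCast_map_algebraMap Q', hQ'q]; rfl
      rw [e]; exact (isCongOne_map_intCast_iff hN0 Q').2 hQ'1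
  -- (5) `q · J(Z) · q⁻¹ = J(Z′)`
  have hconj : conjAct δ (gspRationalToReal δ γ)
      ⟨jOfSiegel δ Z, SiegelComplexRecordSystem.jOfSiegel_mem_C0pm hδ.1 hZ⟩ =
      ⟨jOfSiegel δ Z', SiegelComplexRecordSystem.jOfSiegel_mem_C0pm hδ.1 hZ'⟩ := by
    apply Subtype.ext
    rw [coe_conjAct, conjJ_def]
    have e1 : (((gspRationalToReal δ γ : gspReal δ) : GL (Fin g ⊕ Fin g) ℝ) :
        Matrix (Fin g ⊕ Fin g) (Fin g ⊕ Fin g) ℝ) = q.map (algebraMap ℚ ℝ) := rfl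
    have e2 : (((gspRationalToReal δ γ : gspReal δ) : GL (Fin g ⊕ Fin g) ℝ) :
          Matrix (Fin g ⊕ Fin g) (Fin g ⊕ Fin g) ℝ) *
        ((((gspRationalToReal δ γ : gspReal δ) : GL (Fin g ⊕ Fin g) ℝ)⁻¹ : GL (Fin g ⊕ Fin g) ℝ) :
          Matrix (Fin g ⊕ Fin g) (Fin g ⊕ Fin g) ℝ) = 1 := by
      rw [← Units.val_mul, mul_inv_cancel, Units.val_one]
    rw [e1] at e2 ⊢
    rw [hqJ, Matrix.mul_assoc, e2, Matrix.mul_one]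
  -- (6) the criterion «same adelic component» (★ R60-11)
  exact ((SiegelShimuraSet.mk_eq_mk_iff_of_mem_one _ _ hr).2 ⟨γ, hconj, hK⟩).symm

/-- **Möbius form** ([Milne 2005, Lemma 5.13] at an integral representative; [Lange 2023, Prop. 3.1.4]): under the
hypotheses of `siegelShimuraSet_mk_eq_of_isAdmissibleAt`, `Z = M • Z′` for some `M ∈ Γ_δ(N)` acting through Lange's
`G_D` (★ `gDHom`). [cite: Milne2005ShimuraVarieties, Lemma 5.13 p. 57 (footnote 40)]
[cite: Lange2023AbelianVarietiesComplex, §3.1.2 Prop. 3.1.4 (p0159–p0160)] -/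
theorem exists_siegelLevelGroup_smul_of_isAdmissibleAt (hg : 0 < g) (hδ : IsPolarizationType δ) (hN : 3 ≤ N)
    (hr : r ∈ principalLevelSubgroup δ 1) (hZ : Z ∈ siegelUpperHalfSpace g) (hZ' : Z' ∈ siegelUpperHalfSpace g)
    (P' : PolarizedAbelianSchemeWithLevel g N δ (specOver ℚ ℂ).left)
    (h : IsAdmissibleAt hδ r Z hZ P') (h' : IsAdmissibleAt hδ r Z' hZ' P') :
    ∃ M : symplecticLatticeGroup δ, (M : GL (Fin g ⊕ Fin g) ℤ) ∈ siegelLevelGroup δ N ∧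
      (⟨Z, hZ⟩ : siegelUpperHalfSpace g) = gDHom δ hδ.1 M • (⟨Z', hZ'⟩ : siegelUpperHalfSpace g) :=
  (SiegelShimuraSet.mk_jOfSiegel_eq_mk_jOfSiegel_iff hδ hg hN hr ⟨Z, hZ⟩ ⟨Z', hZ'⟩).1
    (siegelShimuraSet_mk_eq_of_isAdmissibleAt hg hδ hN hr hZ hZ' P' h h')

/-- **Isomorphism form = the `unif_eq_unif_iff` clause of (U)** ([Lange 2023, Prop. 3.1.4 (i)]; the RHS of the field
`unif_eq_unif_iff` of ★ `SiegelModuliDatum` and of (U2+) in ★ `siegelModuli_complexUniformisation`): under the hypotheses of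
`siegelShimuraSet_mk_eq_of_isAdmissibleAt` the marked polarised tori `X_Z`, `X_{Z′}` are isomorphic with rational
representation in `Γ_δ(N)` — `∃ M ∈ Γ_δ(N), ∃ C ∈ GL_g(ℂ), C ∘ Φ_Z = Φ_{Z′} ∘ M` (★ `SiegelModuli.rel_iff_exists_smul`).
[cite: Lange2023AbelianVarietiesComplex, §3.1.2 Prop. 3.1.4 (p0159–p0160)] [cite: Milne2005ShimuraVarieties, §6 Thm. 6.11 p. 74] -/
theorem exists_linearEquiv_siegelPeriodMap_of_isAdmissibleAt (hg : 0 < g) (hδ : IsPolarizationType δ) (hN : 3 ≤ N)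
    (hr : r ∈ principalLevelSubgroup δ 1) (hZ : Z ∈ siegelUpperHalfSpace g) (hZ' : Z' ∈ siegelUpperHalfSpace g)
    (P' : PolarizedAbelianSchemeWithLevel g N δ (specOver ℚ ℂ).left)
    (h : IsAdmissibleAt hδ r Z hZ P') (h' : IsAdmissibleAt hδ r Z' hZ' P') :
    ∃ M ∈ siegelLevelGroup δ N, ∃ C : (Fin g → ℂ) ≃ₗ[ℂ] (Fin g → ℂ),
      ∀ v : Fin g ⊕ Fin g → ℝ, C (siegelPeriodMap δ Z v) = siegelPeriodMap δ Z' (intAct M v) := by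
  obtain ⟨M, hM, hZZ'⟩ := exists_siegelLevelGroup_smul_of_isAdmissibleAt hg hδ hN hr hZ' hZ P' h' h
  exact (rel_iff_exists_smul hδ.1 (siegelLevelGroup_le_symplecticLatticeGroup δ N) hZ hZ').2 ⟨M, hM, hZZ'⟩

end Main

end Literature.AlgebraicGeometry.ModuliOfAbelianVarieties

end
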